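import Summits.HubbardSuperconductivity.HubbardSuperconductivity.Theorems.NodalWardXYVisonPairCostIRDefs
import Summits.HubbardSuperconductivity.HubbardSuperconductivity.Theorems.NodalWardXYVisonPairCostUltraviolet
import Summits.HubbardSuperconductivity.HubbardSuperconductivity.Theorems.NodalWardXYVisonPairCostLogDetFormula

/-!
# Mirror reduction: crux `NodalWardXY.VisonPairCost` (stmt-HubbardSuperconductivity-1266),
# line `Sketch`, stub `stub_mirrorReduction`

`GaugeMirrorIdentity → TwoSidedLogDet → MirrorSetup → ResolventBound → MirrorReduction`
(vocabulary `Theorems/NodalWardXYVisonPairCostIRDefs.lean`): pointwise in `t > 0`, uniformly in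
`L ≥ 4`, `2R ≤ L`, `|D_t| ≤ c S(t) + c S(t)² (1 + |log t|)`, `S = crossS = Σ_{A × B} ‖G_t(a,b)‖²`.
* `MirrorSetup` (`V = P_A V P_A + P_B V P_B`, `N_R = N₀ + P_A V P_A`) and `GaugeMirrorIdentity` with
  `M₀ = N₀`, `ω =` "row in `1 … ⌊L/2⌋`" (`U = mirU L`), `A = strA`, `B = mirB`:
  `‖det(N_R + it)‖² = ‖det(N₀ + it)‖² ‖det(1 + X₁X₂)‖` (`P_A² = P_A`, `P_B² = P_B` identify the
  matrix inside with `mirX1 * mirX2`), i.e. `2 D_t = log ‖det(1 + X₁X₂)‖`;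
* `TwoSidedLogDet` with `K = (2 + c/t)²` (`ResolventBound`): `|2D_t| ≤ √(F₁F₂) + F₁F₂ (5 + 4 log K)`;
* crossing bounds `Fᵢ = ‖Xᵢ‖_F² ≤ K_V² S`, `K_V = 2 (8 + 8|Δ₀| + |μ|)`, by the Schur test
  `frobenius_crossing_le` (row/column sums of `‖W‖ ≤ K` ⇒ `‖P_A G P_B W P_B‖_F² ≤ K² Σ_{A×B}‖G‖²`),
  `‖V(b,j)‖ ≤ 2‖N₀(b,j)‖` (`visonNambu_row_le`) and, for `X₂ = P_B (UGU) P_A V P_A`, `|U| = 1` and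
  the symmetry `G_tᵀ = G_t` (`N₀ᵀ = N₀`: `visonHop_swap`, real bond pairing);
* `log K ≤ 2 (log(2 + c) + |log t|)`; the constant is `K_V⁴ (13 + 8 log(2 + c))`.

Tree facts used: `isHermitian_visonNambu`, `visonHop_swap`, `visonNambu_row_le`,
`det_add_I_smul_ne_zero`, `bdgNambuMatrix_orb_orb`; Mathlib
`Finset.sum_sq_le_sum_mul_sum_of_sq_le_mul`, `Matrix.transpose_nonsing_inv`.  No definition is
introduced.
-/

noncomputable section

-- tree namespace Summit.HubbardSuperconductivity.HubbardSuperconductivity (D-0017)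
set_option linter.dupNamespace false

namespace Summit.HubbardSuperconductivity.HubbardSuperconductivity.Theorems.VisonPairCost

open Literature.Probability.LatticeModels Literature.MathematicalPhysics.QuantumLattice
open Summit.HubbardSuperconductivity.HubbardSuperconductivity.Theses.NodalWardXY
open scoped Matrix

/-! ### The Schur test for the crossing blocks -/

/-- **Frobenius crossing bound** (weighted Cauchy–Schwarz / Schur test): for index sets `A`, `B`,
matrices `G`, `W` and the coordinate projections `P_A`, `P_B`, if every row sum and every column sum
of `‖W‖` is at most `K`, then `‖P_A G P_B W P_B‖_F² ≤ K² Σ_{i ∈ A} Σ_{k ∈ B} ‖G(i,k)‖²`. -/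
theorem frobenius_crossing_le {n : Type*} [Fintype n] [DecidableEq n] (A B : Finset n)
    (G W : Matrix n n ℂ) {K : ℝ} (hK : 0 ≤ K) (hrow : ∀ k, ∑ j, ‖W k j‖ ≤ K)
    (hcol : ∀ j, ∑ k, ‖W k j‖ ≤ K) :
    ∑ i, ∑ j, ‖(Matrix.diagonal (fun i => if i ∈ A then (1 : ℂ) else 0) * G *
        Matrix.diagonal (fun i => if i ∈ B then (1 : ℂ) else 0) * W *
          Matrix.diagonal (fun i => if i ∈ B then (1 : ℂ) else 0)) i j‖ ^ 2 ≤
      K ^ 2 * ∑ i ∈ A, ∑ k ∈ B, ‖G i k‖ ^ 2 := by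
  set X := Matrix.diagonal (fun i => if i ∈ A then (1 : ℂ) else 0) * G *
    Matrix.diagonal (fun i => if i ∈ B then (1 : ℂ) else 0) * W *
      Matrix.diagonal (fun i => if i ∈ B then (1 : ℂ) else 0) with hX
  set α : n → ℝ := fun i => if i ∈ A then 1 else 0 with hα
  set β : n → ℝ := fun i => if i ∈ B then 1 else 0 with hβ
  have hα0 : ∀ i, 0 ≤ α i := fun i => by simp only [hα]; split_ifs <;> norm_num
  have hβ0 : ∀ i, 0 ≤ β i := fun i => by simp only [hβ]; split_ifs <;> norm_num
  have hβ1 : ∀ i, β i ≤ 1 := fun i => by simp only [hβ]; split_ifs <;> norm_num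
  have hαα : ∀ i, α i * α i = α i := fun i => by simp only [hα]; split_ifs <;> norm_num
  have hββ : ∀ i, β i * β i = β i := fun i => by simp only [hβ]; split_ifs <;> norm_num
  have hnA : ∀ i, ‖(if i ∈ A then (1 : ℂ) else 0)‖ = α i := fun i => by
    simp only [hα]; split_ifs <;> simp
  have hnB : ∀ i, ‖(if i ∈ B then (1 : ℂ) else 0)‖ = β i := fun i => by
    simp only [hβ]; split_ifs <;> simp
  -- the entries of `X = P_A G P_B W P_B`
  have hent : ∀ i j, ‖X i j‖ ≤ α i * β j * ∑ k, ‖G i k‖ * β k * ‖W k j‖ := by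
    intro i j
    rw [hX, Matrix.mul_diagonal, Matrix.mul_apply, norm_mul, hnB j]
    simp only [Matrix.mul_diagonal, Matrix.diagonal_mul]
    refine le_trans (mul_le_mul_of_nonneg_right (norm_sum_le _ _) (hβ0 j)) (le_of_eq ?_)
    simp only [norm_mul, hnA, hnB]
    rw [Finset.sum_mul, Finset.mul_sum]
    exact Finset.sum_congr rfl fun k _ => by ring
  -- Cauchy–Schwarz with the weights `‖W k j‖`, then the column sum at `j`
  have hsq : ∀ i j, ‖X i j‖ ^ 2 ≤ α i * β j * (K * ∑ k, ‖G i k‖ ^ 2 * β k * ‖W k j‖) := by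
    intro i j
    have hf0 : ∀ k, 0 ≤ ‖G i k‖ ^ 2 * β k * ‖W k j‖ := fun k =>
      mul_nonneg (mul_nonneg (sq_nonneg _) (hβ0 k)) (norm_nonneg _)
    have hCS : (∑ k, ‖G i k‖ * β k * ‖W k j‖) ^ 2 ≤
        (∑ k, ‖G i k‖ ^ 2 * β k * ‖W k j‖) * ∑ k, ‖W k j‖ :=
      Finset.sum_sq_le_sum_mul_sum_of_sq_le_mul _ (fun k _ => hf0 k) (fun k _ => norm_nonneg _)
        (fun k _ => le_of_eq (by
          calc (‖G i k‖ * β k * ‖W k j‖) ^ 2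
              = ‖G i k‖ ^ 2 * (β k * β k) * ‖W k j‖ * ‖W k j‖ := by ring
            _ = ‖G i k‖ ^ 2 * β k * ‖W k j‖ * ‖W k j‖ := by rw [hββ]))
    calc _ ≤ (α i * β j * ∑ k, ‖G i k‖ * β k * ‖W k j‖) ^ 2 :=
          pow_le_pow_left₀ (norm_nonneg _) (hent i j) 2
      _ = α i * β j * (∑ k, ‖G i k‖ * β k * ‖W k j‖) ^ 2 := by
          rw [mul_pow, mul_pow, sq (α i), sq (β j), hαα, hββ]
      _ ≤ α i * β j * ((∑ k, ‖G i k‖ ^ 2 * β k * ‖W k j‖) * ∑ k, ‖W k j‖) :=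
          mul_le_mul_of_nonneg_left hCS (mul_nonneg (hα0 i) (hβ0 j))
      _ ≤ α i * β j * ((∑ k, ‖G i k‖ ^ 2 * β k * ‖W k j‖) * K) :=
          mul_le_mul_of_nonneg_left (mul_le_mul_of_nonneg_left (hcol j)
            (Finset.sum_nonneg fun k _ => hf0 k)) (mul_nonneg (hα0 i) (hβ0 j))
      _ = α i * β j * (K * ∑ k, ‖G i k‖ ^ 2 * β k * ‖W k j‖) := by rw [mul_comm _ K]
  -- sum over `j`: the row sums at `k`
  have hrowi : ∀ i, ∑ j, ‖X i j‖ ^ 2 ≤ α i * (K ^ 2 * ∑ k, β k * ‖G i k‖ ^ 2) := by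
    intro i
    have hg0 : ∀ k, 0 ≤ ‖G i k‖ ^ 2 * β k := fun k => mul_nonneg (sq_nonneg _) (hβ0 k)
    calc _ ≤ ∑ j, α i * β j * (K * ∑ k, ‖G i k‖ ^ 2 * β k * ‖W k j‖) :=
          Finset.sum_le_sum fun j _ => hsq i j
      _ ≤ ∑ j, α i * (K * ∑ k, ‖G i k‖ ^ 2 * β k * ‖W k j‖) := by
          refine Finset.sum_le_sum fun j _ => ?_
          have h0 : 0 ≤ α i * (K * ∑ k, ‖G i k‖ ^ 2 * β k * ‖W k j‖) :=
            mul_nonneg (hα0 i) (mul_nonneg hK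
              (Finset.sum_nonneg fun k _ => mul_nonneg (hg0 k) (norm_nonneg _)))
          calc α i * β j * (K * ∑ k, ‖G i k‖ ^ 2 * β k * ‖W k j‖)
              = β j * (α i * (K * ∑ k, ‖G i k‖ ^ 2 * β k * ‖W k j‖)) := by ring
            _ ≤ 1 * (α i * (K * ∑ k, ‖G i k‖ ^ 2 * β k * ‖W k j‖)) :=
              mul_le_mul_of_nonneg_right (hβ1 j) h0
            _ = _ := one_mul _
      _ = α i * (K * ∑ k, ‖G i k‖ ^ 2 * β k * ∑ j, ‖W k j‖) := by
          simp only [Finset.mul_sum]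
          rw [Finset.sum_comm]
      _ ≤ α i * (K * ∑ k, ‖G i k‖ ^ 2 * β k * K) :=
          mul_le_mul_of_nonneg_left (mul_le_mul_of_nonneg_left
            (Finset.sum_le_sum fun k _ => mul_le_mul_of_nonneg_left (hrow k) (hg0 k)) hK) (hα0 i)
      _ = α i * (K ^ 2 * ∑ k, β k * ‖G i k‖ ^ 2) := by
          simp only [Finset.mul_sum]
          exact Finset.sum_congr rfl fun k _ => by ring
  -- sum over `i`
  have hA' : ∀ f : n → ℝ, ∑ i, α i * f i = ∑ i ∈ A, f i := fun f => by
    simp only [hα, ite_mul, one_mul, zero_mul, Finset.sum_ite_mem, Finset.univ_inter]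
  have hB' : ∀ f : n → ℝ, ∑ k, β k * f k = ∑ k ∈ B, f k := fun f => by
    simp only [hβ, ite_mul, one_mul, zero_mul, Finset.sum_ite_mem, Finset.univ_inter]
  calc _ ≤ ∑ i, α i * (K ^ 2 * ∑ k, β k * ‖G i k‖ ^ 2) := Finset.sum_le_sum fun i _ => hrowi i
    _ = K ^ 2 * ∑ i ∈ A, ∑ k ∈ B, ‖G i k‖ ^ 2 := by
        rw [Finset.mul_sum, hA']
        exact Finset.sum_congr rfl fun i _ => by rw [hB']

/-- The entries of the half-torus sign `mirU` are unimodular. -/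
theorem norm_mirU_diag (L : ℕ) [NeZero L] (o : Orb (FermionTorus 2 L)) :
    ‖(if 1 ≤ (rowOf L o).val ∧ (rowOf L o).val ≤ L / 2 then (-1 : ℂ) else 1)‖ = 1 := by
  split_ifs <;> simp

section Vison

variable {L : ℕ} [NeZero L]

/-- The spread pairing data are real. -/
theorem star_visonPair (Δ₀ : ℝ) (R : ℕ) (u v : FermionTorus 2 L) :
    star (visonPair L Δ₀ R u v) = visonPair L Δ₀ R u v := by
  unfold visonPair
  rw [Complex.star_def, Complex.conj_ofReal]

/-- **`N_R` is symmetric**: `N_Rᵀ = N_R` (real symmetric hopping `visonHop_swap`, real bond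
pairing entering through the symmetrised coupling `Δ(x,y) + Δ(y,x)`). -/
theorem visonNambu_transpose (μ Δ₀ : ℝ) (R : ℕ) :
    (visonNambu L μ Δ₀ R)ᵀ = visonNambu L μ Δ₀ R := by
  ext o o'
  obtain ⟨⟨x, σ⟩, rfl⟩ : ∃ p : FermionTorus 2 L × Fin 2, toLex p = o := ⟨ofLex o, rfl⟩
  obtain ⟨⟨y, σ'⟩, rfl⟩ : ∃ p : FermionTorus 2 L × Fin 2, toLex p = o' := ⟨ofLex o', rfl⟩
  change visonNambu L μ Δ₀ R (orb y σ') (orb x σ) = visonNambu L μ Δ₀ R (orb x σ) (orb y σ')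
  unfold visonNambu
  rw [bdgNambuMatrix_orb_orb, bdgNambuMatrix_orb_orb, visonHop_swap R y x, star_add, star_add,
    star_visonPair, star_visonPair, add_comm (visonPair L Δ₀ R y x)]
  by_cases hxy : x = y
  · subst hxy
    fin_cases σ <;> fin_cases σ' <;> simp
  · rw [if_neg hxy, if_neg (Ne.symm hxy)]
    fin_cases σ <;> fin_cases σ' <;> simp

/-- **The free resolvent is symmetric**: `G_tᵀ = G_t` (`(Aᵀ)⁻¹ = (A⁻¹)ᵀ` and `N₀ᵀ = N₀`). -/
theorem freeG_transpose (μ Δ₀ t : ℝ) : (freeG L μ Δ₀ t)ᵀ = freeG L μ Δ₀ t := by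
  unfold freeG
  rw [Matrix.transpose_nonsing_inv, Matrix.transpose_add, Matrix.transpose_smul,
    Matrix.transpose_one, visonNambu_transpose]

/-- `|V(b,j)| ≤ 2 |N₀(b,j)|` for the coboundary perturbation `V = U N₀ U − N₀`, `|U| = 1`. -/
theorem norm_mirV_le (μ Δ₀ : ℝ) (b j : Orb (FermionTorus 2 L)) :
    ‖mirV L μ Δ₀ b j‖ ≤ 2 * ‖visonNambu L μ Δ₀ 0 b j‖ := by
  unfold mirV mirU
  rw [Matrix.sub_apply, Matrix.mul_diagonal, Matrix.diagonal_mul]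
  refine (norm_sub_le _ _).trans ?_
  rw [norm_mul, norm_mul, norm_mirU_diag, norm_mirU_diag]
  linarith

/-- Row sums of `‖V‖`: `Σ_j ‖V(b,j)‖ ≤ 2 (8 + 8|Δ₀| + |μ|)` (`visonNambu_row_le`). -/
theorem sum_norm_mirV_row_le (μ Δ₀ : ℝ) (b : Orb (FermionTorus 2 L)) :
    ∑ j, ‖mirV L μ Δ₀ b j‖ ≤ 2 * (8 + 8 * |Δ₀| + |μ|) := by
  calc ∑ j, ‖mirV L μ Δ₀ b j‖ ≤ ∑ j, 2 * ‖visonNambu L μ Δ₀ 0 b j‖ :=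
        Finset.sum_le_sum fun j _ => norm_mirV_le μ Δ₀ b j
    _ = 2 * ∑ j, ‖visonNambu L μ Δ₀ 0 b j‖ := by rw [Finset.mul_sum]
    _ ≤ _ := mul_le_mul_of_nonneg_left (visonNambu_row_le μ Δ₀ 0 b) (by norm_num)

/-- Column sums of `‖V‖`: `Σ_b ‖V(b,j)‖ ≤ 2 (8 + 8|Δ₀| + |μ|)` (symmetry of `N₀` and its row sums). -/
theorem sum_norm_mirV_col_le (μ Δ₀ : ℝ) (j : Orb (FermionTorus 2 L)) :
    ∑ b, ‖mirV L μ Δ₀ b j‖ ≤ 2 * (8 + 8 * |Δ₀| + |μ|) := by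
  calc ∑ b, ‖mirV L μ Δ₀ b j‖ ≤ ∑ b, 2 * ‖visonNambu L μ Δ₀ 0 b j‖ :=
        Finset.sum_le_sum fun b _ => norm_mirV_le μ Δ₀ b j
    _ = 2 * ∑ b, ‖visonNambu L μ Δ₀ 0 j b‖ := by
        rw [Finset.mul_sum]
        exact Finset.sum_congr rfl fun b _ => by
          rw [← Matrix.transpose_apply (visonNambu L μ Δ₀ 0) b j, visonNambu_transpose]
    _ ≤ _ := mul_le_mul_of_nonneg_left (visonNambu_row_le μ Δ₀ 0 j) (by norm_num)

end Vison

/-! ### The reduction -/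

section Reduction

variable {L : ℕ} [NeZero L]

/-- **The gauge-mirror identity for the vison string**: with the cut `(A, B) = (strA, mirB)` and the
half-torus sign `U = mirU L` (`MirrorSetup`: `V = P_A V P_A + P_B V P_B`, `N_R = N₀ + P_A V P_A`),
`‖det(N_R + it)‖² = ‖det(N₀ + it)‖² ‖det(1 + X₁ X₂)‖` (`P_A² = P_A`, `P_B² = P_B`). -/
theorem norm_det_visonNambu_sq_eq (hGM : GaugeMirrorIdentity) (hSetup : MirrorSetup) (hL : 4 ≤ L)
    (μ Δ₀ : ℝ) {R : ℕ} (hR : 2 * R ≤ L) {t : ℝ} (ht : 0 < t) :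
    ‖(visonNambu L μ Δ₀ R + ((t : ℂ) * Complex.I) •
        (1 : Matrix (Orb (FermionTorus 2 L)) (Orb (FermionTorus 2 L)) ℂ)).det‖ ^ 2 =
      ‖(visonNambu L μ Δ₀ 0 + ((t : ℂ) * Complex.I) •
        (1 : Matrix (Orb (FermionTorus 2 L)) (Orb (FermionTorus 2 L)) ℂ)).det‖ ^ 2 *
        ‖(1 + mirX1 L μ Δ₀ R t * mirX2 L μ Δ₀ R t).det‖ := by
  obtain ⟨hdisj, hsplit, hNR⟩ := hSetup L hL μ Δ₀ R hR
  -- the projections are idempotent; the matrix inside the determinant is `X₁ X₂`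
  have hPP : ∀ T : Finset (Orb (FermionTorus 2 L)),
      (Matrix.diagonal fun o => if o ∈ T then (1 : ℂ) else 0) *
          (Matrix.diagonal fun o => if o ∈ T then (1 : ℂ) else 0) =
        Matrix.diagonal fun o => if o ∈ T then (1 : ℂ) else 0 := fun T => by
    rw [Matrix.diagonal_mul_diagonal]
    congr 1
    funext o
    split_ifs <;> norm_num
  have hPAPA : projA L R * projA L R = projA L R := hPP (strA L R)
  have hPBPB : projB L R * projB L R = projB L R := hPP (mirB L R)
  have hPBPB' : ∀ Y : Matrix (Orb (FermionTorus 2 L)) (Orb (FermionTorus 2 L)) ℂ,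
      projB L R * (projB L R * Y) = projB L R * Y := fun Y => by
    rw [← mul_assoc, hPBPB]
  have hXX : projA L R * freeG L μ Δ₀ t * (projB L R * mirV L μ Δ₀ * projB L R) *
      (mirU L * freeG L μ Δ₀ t * mirU L) * (projA L R * mirV L μ Δ₀ * projA L R) * projA L R =
        mirX1 L μ Δ₀ R t * mirX2 L μ Δ₀ R t := by
    simp only [mirX1, mirX2, mul_assoc, hPAPA, hPBPB']
  -- the abstract identity for `M₀ = N₀`, `ω = [row ∈ 1 … ⌊L/2⌋]`, `A = strA`, `B = mirB`
  obtain ⟨ω, hω⟩ : ∃ ω : Orb (FermionTorus 2 L) → Bool,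
      (Matrix.diagonal fun i => if ω i then (-1 : ℂ) else 1) = mirU L :=
    ⟨fun o => decide (1 ≤ (rowOf L o).val ∧ (rowOf L o).val ≤ L / 2), by
      simp only [mirU, decide_eq_true_eq]⟩
  have hGM1 := hGM (Orb (FermionTorus 2 L)) (visonNambu L μ Δ₀ 0) (isHermitian_visonNambu μ Δ₀ 0)
    ω (strA L R) (mirB L R) hdisj
  rw [hω] at hGM1
  rw [hNR, ← hXX]
  exact hGM1 hsplit t ht

/-- **`2 D_t = log ‖det(1 + X₁ X₂)‖`** (`det(N + it) ≠ 0` for Hermitian `N`, `t ≠ 0`). -/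
theorem two_mul_logDetKernel_eq (hGM : GaugeMirrorIdentity) (hSetup : MirrorSetup) (hL : 4 ≤ L)
    (μ Δ₀ : ℝ) {R : ℕ} (hR : 2 * R ≤ L) {t : ℝ} (ht : 0 < t) :
    2 * logDetKernel (visonNambu L μ Δ₀ R) (visonNambu L μ Δ₀ 0) t =
      Real.log ‖(1 + mirX1 L μ Δ₀ R t * mirX2 L μ Δ₀ R t).det‖ := by
  have hid := norm_det_visonNambu_sq_eq hGM hSetup hL μ Δ₀ hR ht
  have hdetR := det_add_I_smul_ne_zero (isHermitian_visonNambu (L := L) μ Δ₀ R) ht.ne'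
  have hdet0 := det_add_I_smul_ne_zero (isHermitian_visonNambu (L := L) μ Δ₀ 0) ht.ne'
  unfold logDetKernel
  set a := ‖(visonNambu L μ Δ₀ R + ((t : ℂ) * Complex.I) •
        (1 : Matrix (Orb (FermionTorus 2 L)) (Orb (FermionTorus 2 L)) ℂ)).det‖
  set b := ‖(visonNambu L μ Δ₀ 0 + ((t : ℂ) * Complex.I) •
        (1 : Matrix (Orb (FermionTorus 2 L)) (Orb (FermionTorus 2 L)) ℂ)).det‖
  set d := ‖(1 + mirX1 L μ Δ₀ R t * mirX2 L μ Δ₀ R t).det‖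
  have ha0 : 0 < a := norm_pos_iff.mpr hdetR
  have hb0 : 0 < b := norm_pos_iff.mpr hdet0
  have hdab : d = a ^ 2 / b ^ 2 := by
    rw [eq_div_iff (pow_ne_zero 2 hb0.ne'), hid, mul_comm]
  rw [hdab, Real.log_div (pow_ne_zero 2 ha0.ne') (pow_ne_zero 2 hb0.ne'), Real.log_pow,
    Real.log_pow]
  push_cast
  ring

/-- **Crossing bound for `X₁`**: `‖X₁‖_F² ≤ K_V² S`, `K_V = 2 (8 + 8|Δ₀| + |μ|)`. -/
theorem frobenius_mirX1_le (μ Δ₀ : ℝ) (R : ℕ) (t : ℝ) :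
    ∑ i, ∑ j, ‖mirX1 L μ Δ₀ R t i j‖ ^ 2 ≤ (2 * (8 + 8 * |Δ₀| + |μ|)) ^ 2 * crossS L μ Δ₀ R t :=
  frobenius_crossing_le (strA L R) (mirB L R) (freeG L μ Δ₀ t) (mirV L μ Δ₀) (by positivity)
    (sum_norm_mirV_row_le μ Δ₀) (sum_norm_mirV_col_le μ Δ₀)

/-- **Crossing bound for `X₂`**: `‖X₂‖_F² ≤ K_V² S` (`|U| = 1` and the symmetry of `G_t` turn
`Σ_{B × A} ‖(UGU)(b,a)‖²` into `S`). -/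
theorem frobenius_mirX2_le (μ Δ₀ : ℝ) (R : ℕ) (t : ℝ) :
    ∑ i, ∑ j, ‖mirX2 L μ Δ₀ R t i j‖ ^ 2 ≤ (2 * (8 + 8 * |Δ₀| + |μ|)) ^ 2 * crossS L μ Δ₀ R t := by
  have h := frobenius_crossing_le (mirB L R) (strA L R) (mirU L * freeG L μ Δ₀ t * mirU L)
    (mirV L μ Δ₀) (by positivity) (sum_norm_mirV_row_le μ Δ₀) (sum_norm_mirV_col_le μ Δ₀)
  have hUGU : ∑ i ∈ mirB L R, ∑ k ∈ strA L R,
      ‖(mirU L * freeG L μ Δ₀ t * mirU L) i k‖ ^ 2 = crossS L μ Δ₀ R t := by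
    unfold crossS
    rw [Finset.sum_comm]
    refine Finset.sum_congr rfl fun a _ => Finset.sum_congr rfl fun b _ => ?_
    unfold mirU
    rw [Matrix.mul_diagonal, Matrix.diagonal_mul, norm_mul, norm_mul, norm_mirU_diag,
      norm_mirU_diag, one_mul, mul_one, ← Matrix.transpose_apply (freeG L μ Δ₀ t) a b,
      freeG_transpose]
  rw [hUGU] at h
  exact h

end Reduction

/-- `log (2 + c/t)² ≤ 2 (log(2 + c) + |log t|)` for `c ≥ 0`, `t > 0` (split at `t = 1`). -/
theorem log_sq_two_add_div_le {c t : ℝ} (hc : 0 ≤ c) (ht : 0 < t) :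
    Real.log ((2 + c / t) ^ 2) ≤ 2 * (Real.log (2 + c) + |Real.log t|) := by
  have hct : 0 ≤ c / t := div_nonneg hc ht.le
  rw [Real.log_pow, Nat.cast_ofNat]
  refine mul_le_mul_of_nonneg_left ?_ (by norm_num)
  rcases le_or_gt 1 t with ht1 | ht1
  · have h1 : c / t ≤ c := div_le_self hc ht1
    have h2 : Real.log (2 + c / t) ≤ Real.log (2 + c) :=
      Real.log_le_log (by linarith) (by linarith)
    linarith [abs_nonneg (Real.log t)]
  · have h1 : 2 + c / t ≤ (2 + c) / t := by
      rw [add_div, add_le_add_iff_right, le_div_iff₀ ht]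
      linarith
    have h2 : Real.log (2 + c / t) ≤ Real.log ((2 + c) / t) := Real.log_le_log (by linarith) h1
    rw [Real.log_div (by linarith) ht.ne'] at h2
    have h3 : |Real.log t| = -Real.log t := abs_of_nonpos (Real.log_nonpos ht.le ht1.le)
    linarith

/-- **Bookkeeping of the constants**: from `|2D| ≤ √(F₁F₂) + F₁F₂ (5 + 4 log K)`, `Fᵢ ≤ K_V² S`,
`log K ≤ 2(ℓ + L_t)` to `|D| ≤ K_V⁴ M S + K_V⁴ M S² (1 + L_t)`, `M = 13 + 8ℓ`. -/
theorem mirror_bookkeeping {D S F₁ F₂ KV M ℓ Lt LK : ℝ} (hKV : 16 ≤ KV) (hM : M = 13 + 8 * ℓ)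
    (hℓ : 0 ≤ ℓ) (hLt : 0 ≤ Lt) (hS : 0 ≤ S) (hF₂ : 0 ≤ F₂) (hF1 : F₁ ≤ KV ^ 2 * S)
    (hF2 : F₂ ≤ KV ^ 2 * S) (hLK : LK ≤ 2 * (ℓ + Lt)) (hLK0 : 0 ≤ 5 + 4 * LK)
    (hmain : |2 * D| ≤ Real.sqrt (F₁ * F₂) + F₁ * F₂ * (5 + 4 * LK)) :
    |D| ≤ KV ^ 4 * M * S + KV ^ 4 * M * S ^ 2 * (1 + Lt) := by
  have hKV0 : 0 ≤ KV := by linarith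
  have hM1 : 1 ≤ 2 * M := by rw [hM]; linarith
  have hT0 : 0 ≤ KV ^ 2 * S := mul_nonneg (pow_nonneg hKV0 2) hS
  have hFF : F₁ * F₂ ≤ (KV ^ 2 * S) ^ 2 := by
    rw [sq]
    exact mul_le_mul hF1 hF2 hF₂ hT0
  have hsqrt : Real.sqrt (F₁ * F₂) ≤ KV ^ 2 * S := by
    rw [← Real.sqrt_sq hT0]
    exact Real.sqrt_le_sqrt hFF
  have h1 := add_le_add hsqrt (mul_le_mul_of_nonneg_right hFF hLK0)
  have h2 := mul_le_mul_of_nonneg_left (show 5 + 4 * LK ≤ 5 + 8 * (ℓ + Lt) by linarith)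
    (sq_nonneg (KV ^ 2 * S))
  have hA : KV ^ 2 * S ≤ 2 * (KV ^ 4 * M * S) := by
    have e1 : KV ^ 2 ≤ KV ^ 4 := pow_le_pow_right₀ (by linarith) (by norm_num)
    calc KV ^ 2 * S ≤ KV ^ 4 * S := mul_le_mul_of_nonneg_right e1 hS
      _ = KV ^ 4 * S * 1 := (mul_one _).symm
      _ ≤ KV ^ 4 * S * (2 * M) :=
          mul_le_mul_of_nonneg_left hM1 (mul_nonneg (pow_nonneg hKV0 4) hS)
      _ = 2 * (KV ^ 4 * M * S) := by ring
  have hB : (KV ^ 2 * S) ^ 2 * (5 + 8 * (ℓ + Lt)) ≤ 2 * (KV ^ 4 * M * S ^ 2 * (1 + Lt)) := by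
    have e1 : 5 + 8 * (ℓ + Lt) ≤ 2 * M * (1 + Lt) := by
      rw [hM]
      linarith [mul_nonneg hℓ hLt]
    calc (KV ^ 2 * S) ^ 2 * (5 + 8 * (ℓ + Lt)) = KV ^ 4 * S ^ 2 * (5 + 8 * (ℓ + Lt)) := by ring
      _ ≤ KV ^ 4 * S ^ 2 * (2 * M * (1 + Lt)) :=
          mul_le_mul_of_nonneg_left e1 (mul_nonneg (pow_nonneg hKV0 4) (sq_nonneg S))
      _ = 2 * (KV ^ 4 * M * S ^ 2 * (1 + Lt)) := by ring
  rw [abs_mul, abs_two] at hmain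
  linarith

/-! ### The stub -/

/-- **Mirror reduction** (registered stub `stub_mirrorReduction` of the line `Sketch`): the
gauge-mirror identity, the two-sided log-determinant estimate, the mirror set-up and the resolvent
bound give, pointwise in `t > 0` and uniformly in `L ≥ 4`, `2R ≤ L`,
`|D_t| ≤ c S(t) + c S(t)² (1 + |log t|)` with the free crossing Hilbert–Schmidt sum `S = crossS` and
`c = K_V⁴ (13 + 8 log(2 + c_res))`, `K_V = 2 (8 + 8|Δ₀| + |μ|)`. -/
theorem stub_mirrorReduction :
    GaugeMirrorIdentity → TwoSidedLogDet → MirrorSetup → ResolventBound → MirrorReduction := by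
  intro hGM hTS hSetup hRes μ Δ₀
  obtain ⟨c, hc0, hc⟩ := hRes μ Δ₀
  -- constants: `KV` bounds the row and column sums of `‖V‖`, `M` absorbs `log K`
  set KV : ℝ := 2 * (8 + 8 * |Δ₀| + |μ|) with hKV
  set M : ℝ := 13 + 8 * Real.log (2 + c) with hM
  have hKV16 : 16 ≤ KV := by
    have h1 := abs_nonneg Δ₀
    have h2 := abs_nonneg μ
    rw [hKV]
    linarith
  have hlog2c : 0 ≤ Real.log (2 + c) := Real.log_nonneg (by linarith)
  refine ⟨KV ^ 4 * M, mul_nonneg (pow_nonneg (by linarith) 4) (by rw [hM]; linarith), ?_⟩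
  intro L _ hL R hR t ht
  -- the two-sided estimate with `K = (2 + c/t)²`, rewritten with `2 D_t = log ‖det(1 + X₁X₂)‖`
  have hK1 : (1 : ℝ) ≤ (2 + c / t) ^ 2 :=
    one_le_pow₀ (by have := div_nonneg hc0 ht.le; linarith)
  have hTS1 := hTS (Orb (FermionTorus 2 L)) (mirX1 L μ Δ₀ R t) (mirX2 L μ Δ₀ R t)
    ((2 + c / t) ^ 2) hK1 (fun v => by
      calc (star v ⬝ᵥ v).re ≤ (2 + c / t) ^ 4 * _ := hc L hL R hR t ht v
        _ = ((2 + c / t) ^ 2) ^ 2 * _ := by ring)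
  rw [← two_mul_logDetKernel_eq hGM hSetup hL μ Δ₀ hR ht] at hTS1
  -- the crossing bounds and the bookkeeping
  have hF1 := frobenius_mirX1_le (L := L) μ Δ₀ R t
  have hF2 := frobenius_mirX2_le (L := L) μ Δ₀ R t
  rw [← hKV] at hF1 hF2
  exact mirror_bookkeeping hKV16 hM hlog2c (abs_nonneg (Real.log t))
    (Finset.sum_nonneg fun _ _ => Finset.sum_nonneg fun _ _ => sq_nonneg _)
    (Finset.sum_nonneg fun _ _ => Finset.sum_nonneg fun _ _ => sq_nonneg _) hF1 hF2
    (log_sq_two_add_div_le hc0 ht) (by have := Real.log_nonneg hK1; linarith) hTS1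

end Summit.HubbardSuperconductivity.HubbardSuperconductivity.Theorems.VisonPairCost

end
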